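import Summits.QuantumFields.YangMills.Theorems.BalabanUVNodesN19RateEdgeHolderD4AtRuns
import Summits.QuantumFields.YangMills.Theorems.BalabanUVNodesN19RateEdgeHolderAlong
import Summits.QuantumFields.YangMills.Theorems.BalabanUVNodesN19CoreEdgeFSCComposer

/-!
# BalabanUVNodes ∕ N19 — K3⁷ v2's N19′ SLOT UNDER THE `ForSmallCouplings` PREFIX, MODULO THE LINK READING AT THE RUNS OF RECORD WITH THE β-WINDOW READ FROM K1⁷:
# this seat's `…D4AtRuns` (p593217) re-issued over the along-the-runs rate edge (`…N19RateEdgeHolderAlong`, INTENT-6) — (v′-17)'s `0 < bβ ∧ EventualLowerH bβ R.u3.γ k₀β D.βfun`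
# (UNPRINTED box-form lower β-bound) DISCHARGED from the lower half of K1⁷'s interval-form window along the runs of record; nine (v′-17)∕(T) conjuncts gone in all

Cell `pub-ymgap`, HUMAN RULING D-0062 (Track A) + D-0149 (work-bound push, director-ym №197), WIDTH SEAT `pub-ymgap-dag-n19-w3` (N19 NE7, seat 3 of 3), generation g2;
bus INTENT-7.  Cluster item K3⁷ «SpineGivenEndpointR13SepCoPH» (stmt-QuantumFields-20544), plan's skeleton v2 145a664ea9c38a7b ∕ v3 02f6f498332fdbee (N19′'s slot
`KeyedCoreEdgeHolderD4 β cr (rrOfRecord 𝔯 ksel)` UNCHANGED in v3, rates predicate `PHolderD4 β`); filed `--kind proof --supports` that item `--as helper` (it proves no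
registered stub).  COUNT-NEUTRAL.  THEOREMS ONLY; 0 `def`; 0 `sorry`; `N`-generic, guard-generic `G`, reading-generic `cr`; NO Theses import.  Imports this seat's `…D4AtRuns`
(§1 `runClauses_of_pinnedRuns_tuned` ∕ `invSq_of_pinnedRuns_along` + J's seven named facts through its imports), `…N19RateEdgeHolderAlong` (E′ = dag-n19-d's E with the
β-window letter read along the runs; brings INTENT-5 `…N19InEdgesAlongRuns`: `alongLower_runFlow_of_tuned`, `alongLower_of_pinnedRuns`) and `…N19CoreEdgeFSCComposer`
(p595910, §3's plug) — CITED BY NAME, none edited.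

WHAT CHANGES w.r.t. `…D4AtRuns` (p593217).  There the link reading at the runs of record still displayed `0 < bβ ∧ EventualLowerH bβ R.u3.γ k₀β D.βfun` with the smallness
window `R.u3.cr·R.u3.C₉·R.u3.ω·((k₀β+1)γ³ + 2γ∕bβ) ≤ (1−ρ)∕2`, `bβ k₀β` ∃-bound — a lower β-bound on the WHOLE γ-box that only the K1-side BOX binder `BetaLowerH` supplies
(g0 §3).  The knit reads it ONLY along the two runs (INTENT-5's header), and along the runs of record of a tuned bare sequence the lower half of K1⁷'s interval-form window
`BetaBoundsInInterval D.C.toB12 γ₀ b b′` IS that bound from scale 0 on (`alongLower_runFlow_of_tuned`).  So here: `hlink`'s prefix carries the window's lower constant `b`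
with `0 < b` and the along-the-runs bound as ANTECEDENTS (information the reading may use), the binders `bβ k₀β` and the two conjuncts are REMOVED, and the smallness window
reads AT THE TUNING RADIUS `γ ≤ θ.γ` (E′'s radius letter `γt := γ`; the tuned runs live in the γ-box): `R.u3.cr * R.u3.C₉ * R.u3.ω * (γ ^ 3 + 2 * γ / b) ≤ (1 − R.u3.ρ) ∕ 2`
(`k₀β := 0`, `bβ := b`; WEAKER than at `R.u3.γ = θ.γ`; still a RESIDUAL-letter clause of `𝔯.lit`, small for small `γ` at fixed letters).  Everything else
is `…D4AtRuns`'s clause verbatim (the two pin clauses, (i), `0 ≤ S.vol`, (ii-m), (iii), (iv), (ii-v-A∕B), (ii-d), (v′-16), `0 < ρ ≤ θc`, (T)'s `DecayBound` ∕ discs ∕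
constants, the selector, `θ.γ² ≤ e⁻¹`).  Versus v9: 8 (J) + 7 (AtRuns) + 2 (here) conjuncts discharged at any reading.

WHAT THIS FILE PROVES (`R := rateCarriersOfRecord₁₃CoPH 𝔯 F θ hP g₀ os k`, `D := datumOfRecord₁₃CoPH F N θ hP`, `S := cr F θ hP g₀ os`).
* §1 ★★ `h19HolderD4_datumOfRecord₁₃CoPH_of_linkReadingAtRunsAlong_tuned` — on TUNED bare sequences (`D.Tuned γ gIR g₀`, `γ ≤ θ.γ`) with `b ≤ β ≤ b′` ALONG THE RUNS OF
  RECORD (`0 < b`): `PHolderD4 β D R → ∃ δ, NE7.Core S … δ ∧ Summable δ` MODULO `hlink`; proof = E′ at the same-tuple pair predicate carrying the slot's `ReadOutAt ∧ ρ < 1`,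
  the tuning, `γ ≤ θ.γ`, `0 < b` and both along-the-runs bounds; v9's along-form clause REASSEMBLED from `hlink`, J's seven named facts, AtRuns §1's seven run clauses and
  INTENT-5's transport `alongLower_of_pinnedRuns` (`bβ := b`, `k₀β := 0`, `γt := γ`, `β′_T := max b′ 0`).
* §2 ★★ `forSmallCouplings_h19HolderD4_datumOfRecord₁₃CoPH_of_linkReadingAtRunsAlong` — UNDER THE CRUX's PREFIX BY NAME from K1⁷'s window `BetaBoundsInInterval D.C.toB12 γ₀ b b′`
  with `0 < b` (BOTH halves now read: lower → the AF weights, upper → (T)'s running), threshold `min γ₀ θ.γ` · ★ `…_keyed`-shape `(ks)` — v2∕v3's slot text under the prefix.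
* §3 ★★ `hybridNE7Under_datumOfRecord₁₃CoPH_of_linkReadingAtRunsAlong` — THE PLUG at any reading `cr`: h20∕h21 at `cr`, ∀-`g₀` `PHolderD4` rates, `hx` at `cr` (leaf D shapes),
  K1⁷'s window with `0 < b` at every guarded admissible tuple, and `hlink` ⇒ `HybridNE7Under (datumOfRecord₁₃CoPH F N θ hP) (EndpointExistence …)` (this seat's composer
  p595910 `…_betaWindowPos`); imports `…N19CoreEdgeFSCComposer`.

HONEST FRAMING.  Count-neutral kernel bookkeeping (one reassembly + applications); `hlink` is a HYPOTHESIS (NODE O's world; 0 instances in the tree); `D.Tuned` (K2⁷ ∕ [B12]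
Thm 2 content at the datum of record) and `BetaBoundsInInterval` with `0 < b` (K1⁷'s β-window binder `stub_betaWindow13PWS`'s currency — `BetaBoundsInInterval w.C.toB12 w.γ w.b w.βup` at a world `w` with `DagBinding.WorldP.b_pos : 0 < w.b`; lower half UNPRINTED, T09.F;
upper half [Balaban1987RG1] (1.22) p. 264, proof deferred in print) are HYPOTHESES; the rates predicate is the slot's own hypothesis; `cr 𝔯 G` PARAMETERS.  NOT a proof of
`stub_expansion13H`; no skeleton text touched, no v3.x proposed.  NE7 for Bałaban's two runs is NOT PRINTED and NOT proved; nothing of Bałaban's is asserted or instantiated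
(K0⁷ OPEN); N19 NOT discharged; K3⁷ NOT claimed; Track A count unmoved (typed 28∕28 · discharged 5∕27 · A 5∕28).  One finite four-torus at fixed ε, rung (B)+1 — R4 closes
the CONDITIONAL finite-𝕋⁴ rung `BalabanLadder.UV` only; NOT infinite volume, NOT OS on ℝ⁴, NOT a mass gap; the YM mass gap (Clay) is NOT proved by any of this.  Standard
axioms.  Supersedes nothing; edits nothing.  Shape reference: [Balaban1987RG1] (0.31) p. 259 ∕ Thm 2 p. 259 (the NAMES of the hypotheses — nothing asserted).
-/

set_option autoImplicit false

noncomputable section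

open Finset MeasureTheory
open scoped BigOperators Matrix Matrix.Norms.L2Operator

namespace Summit.QuantumFields.YangMills.BalabanUVNodes.N19RateEdgeHolderD4AtRunsAlong

open Literature.MathematicalPhysics.QuantumFieldTheory.Balaban1983to89
open T4OutputRate T4RecentScale T4GoodClassBudget T4CauchySum T4TowerRateComposition T4TowerRateDischarge
open T4EtaRateMin (Readings NE3Shape)
open T4RateLiaison (GaugeDominated)
open T4CouplingMatching (EventualLowerH)
open FlowStep (RGEqH prefixOf)
open TreeLengthTorus (TFaceConnected torusTreeLen)
open B12TreeDecay (kappa₀)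
open Summit.QuantumFields.BalabanUV.T4Continuum
open AveragingDeficitDualResidual (dualC1 dualC2)
open AveragingDeficitDerivWallProof (wallConst)
open AveragingDeficitPeriodicCounting (IsPeriodicDir)
open MinimalActionSandwich (IsMinimiser minAct)
open MinimalActionRate (sfClass)
open MinimalActionRefine (RegularSup gradConst)
open NE3EnergyShapes (IsUnitarySite IsPeriodicSite)
open NE3.LeafIndexSockets (LeafH3sup)
open Summit.QuantumFields.BalabanUV.T4Continuum.Spine
open Summit.QuantumFields.BalabanUV.T4Continuum.Spine.NE4 (runFlow box_and_pin_of_tuned)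
open Summit.QuantumFields.BalabanUV.T4Continuum.NE1p.DressedRoot (DressedTower DressedStabilityStrict)
open Summit.QuantumFields.YangMills.BalabanUVNodes.N19LedgerLinkSync (LedgerDataSync LedgerAtSync)
open YMDAG.UVSplit (SpineCarriers SpineRecordPred InputsPred U3Carriers RateCarriers RateRecordPred N14At N18At N22At ReadOutAt)
open Summit.QuantumFields.YangMills.BalabanUVNodes.N16HolderDefs (CovRootHolder N16HolderAt)
open Summit.QuantumFields.YangMills.BalabanUVNodes.SpineRatesHolder (RatesHolderAt)
open Literature.MathematicalPhysics.QuantumFieldTheory.Balaban1983to89.T4Continuum (T4Family ULoop)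
open T4WeightBudget (RelWeightBound)
open T4IndicatorShell (ShellWeightBound)
open T4ContinuumYM4Torus (ForSmallCouplings)
open T4ApexHybrid (HybridNE7Under)
open YMDAG.UVSplit (Datum RateReading₁₃CoPH rateCarriersOfRecord₁₃CoPH)
open YMDAG.UVSplit (SpineReading₁₃CoPH ShellSplit₁₃CoPH)
open Node00 (Stage13HParams datumOfRecord₁₃CoPH SiteSeqKey)
open Summit.QuantumFields.YangMills.BalabanUVNodes.N19RateEdgeHolderAlong (rateEdge_of_linkReadingAlong_byName_pairDiscC1Holder)
open Summit.QuantumFields.YangMills.BalabanUVNodes.N19RateEdgeHolderD4AtRuns (runClauses_of_pinnedRuns_tuned invSq_of_pinnedRuns_along)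
open Summit.QuantumFields.YangMills.BalabanUVNodes.N19InEdgesAlongRuns (alongLower_runFlow_of_tuned alongLower_of_pinnedRuns)
open Summit.QuantumFields.YangMills.BalabanUVNodes.N19CoreEdgeFSCComposer (keyedGuarded₁₃CoPH_of_fscCoreEdgeHolderD4_betaWindowPos)
open Summit.QuantumFields.YangMills.BalabanUVNodes.N19RateEdgeRecordRunLetters
  (rgEqH_congr two_le_ne3_L_rateCarriersOfRecord₁₃CoPH signs_rateCarriersOfRecord₁₃CoPH_of_readOutAt window_rateCarriersOfRecord₁₃CoPH_sq_le_exp_neg_one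
    gamma_pos_rateCarriersOfRecord₁₃CoPH)
open Summit.QuantumFields.YangMills.BalabanUVNodes.N19RateEdgeRecordRunLettersTuned
  (invSq_le_of_rgEqH_along rgEqH_runFlow_datumOfRecord₁₃CoPH_of_tuned betaAlong_runFlow_le_of_betaBoundsInInterval)

/-! ## §1 The link reading AT THE RUNS OF RECORD, β-window along the runs, on tuned bare sequences ⇒ N19′'s edge GIVEN `PHolderD4 β` -/

section AtRecordRunsAlong

variable {N : ℕ} [NeZero N]
  (cr : (F : T4Family) → (θ : Stage13HParams F N) → θ.Provisos₁₃CoPH F N → (ℕ → ℝ) → List (ULoop F) → SpineCarriers)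
  (𝔯 : RateReading₁₃CoPH N) (G : ∀ {F : T4Family}, Stage13HParams F N → Prop) {β : ℝ} (hβ1 : β ≤ 1)
  (hlink : ∀ (F : T4Family) (θ : Stage13HParams F N) (hP : θ.Provisos₁₃CoPH F N), G θ → θ.Admissible F N →
    ∀ (γ gIR b : ℝ) (g₀ : ℕ → ℝ), (datumOfRecord₁₃CoPH F N θ hP).Tuned γ gIR g₀ → γ ≤ θ.γ → 0 < b →
    (∀ K m, 0 ≤ m → m < K → b ≤ (datumOfRecord₁₃CoPH F N θ hP).βfun m (prefixOf (runFlow (datumOfRecord₁₃CoPH F N θ hP) g₀ K) m)) →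
    ∀ (os : List (ULoop F)) (k : ℕ),
      let S : SpineCarriers := cr F θ hP g₀ os
      let R : RateCarriers N := rateCarriersOfRecord₁₃CoPH 𝔯 F θ hP g₀ os k
      let D : Datum F N := datumOfRecord₁₃CoPH F N θ hP
      letI := S.dec
      -- the tuple's window letter (replaces (T)'s clause over `R.u3.W`; dag-n19-w3 `window_rateCarriersOfRecord₁₃CoPH_sq_le_exp_neg_one`)
      θ.γ ^ 2 ≤ Real.exp (-1) ∧
      ∃ (_ : DecidableEq R.u3.C.Dom) (F' : Type) (ι' X' : Type) (_ : MeasurableSpace ι')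
        (L : LedgerDataSync R.u3.C F' ι' S.ι) (Rd : Readings ι' X') (bsel : (ℕ → ℝ) → ℝ) (EB : Functional R.u3.C R.u3.C.BgB)
        (θc θ₃ : ℝ) (g : ℕ → ℕ → ℝ)
        (uA : ℕ → ι' → R.u3.C.BgA) (uB : ℕ → ι' → R.u3.C.BgB)
        (Pf : ℕ → Params) (d₀ L₀ Koff : ℕ) (cells : (K j : ℕ) → R.u3.C.Dom → Finset (Site (Pf K) j))
        (H033 : Flow → ℕ → Prop) (I : Type) (fam : I → B14.Sect2Data) (Lb βw : ℝ) (κ₁ : ℕ) (Gv Cl : ℝ) (K₁ : ℕ)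
        (Λ₀ N₀ : ℝ) (dressed : R.u3.C.Dom → Prop) (_ : DecidablePred dressed)
        -- N16-side letters: regime, selection, reading map, NE7 route-#1 side letters, offset
        (c' t ε₁ θ γ₃ l₁ : ℝ)
        (sel : ℕ → (B7Prop1Explicit.Site 4 → Fin 4 → (Matrix (Fin N) (Fin N) ℂ)ˣ) → (B7Prop1Explicit.Site 4 → Fin 4 → (Matrix (Fin N) (Fin N) ℂ)ˣ))
        (rd : ι' → (B7Prop1Explicit.Site 4 → Fin 4 → (Matrix (Fin N) (Fin N) ℂ)ˣ)) (k₀ : ℕ)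
        -- (N17-side letters: the infrared pin `gIR` is the TUNED value and the β-window is K1⁷'s lower constant `b` from scale 0 — no binders left)
        -- TUBE letters of the bracket (T): the (1.18) constant, the layer factor and (2.28)'s `C₁, q₁` (the flow's `β′_T` is no longer a binder)
        (E₀T κ₁T C₁T : ℝ) (q₁ : ℕ),
        -- ★ THE RUNS OF RECORD, window-extended by the infrared value: `g` IS `runFlow D g₀ K` up to the cutoff and `gIR` beyond (replaces the
        -- (0.20)-run identification, the infrared pin, the box, both window memberships, (T)'s upper running and its sign `0 ≤ β′_T`)
        (∀ K i, i ≤ K → g K i = runFlow D g₀ K i) ∧ (∀ K i, K < i → g K i = gIR) ∧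
        -- the run-B functional is the first-coupling family read through the selector
        EB = (fun s => R.u3.EB (bsel s) s) ∧
        -- (i) the ledger predicate for whatever size data and census constants meet their clauses
        (∀ (Sz : ℕ → ℝ → S.ι → ℕ → ℝ) (E₀ : ℝ) (m : ℕ) (a : ℝ) (Cw Λg : ℝ),
          (∀ K t, |t| ≤ S.l₀ → ∀ τ ∈ S.T K \ S.Bad K t, ∀ v ∈ Rd.dom, ∀ j ≤ K,
            |∑ X ∈ L.fac K t τ with R.u3.C.scale X = j,
                (Real.log (Real.exp (EB (fun i => g (K + 1) (i + 1)) (uB K v) X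
                    - EB (fun i => g (K + 1) (i + 1)) L.oneB X))
                  - Real.log (Real.exp (R.u3.EA (g K) (uA K v) X - R.u3.EA (g K) L.oneA X)))| ≤ Sz K t τ j) →
          0 ≤ E₀ → 0 < a → a < 1 →
          (∀ K t, |t| ≤ S.l₀ → ∀ τ ∈ S.T K \ S.Bad K t, ∀ j ≤ K,
            Sz K t τ j ≤ S.vol * (E₀ * ((K : ℝ) + 1) ^ m * a ^ (K - j))) →
          (∀ K, Multiplicity (L.All K) R.u3.C.scale (fun X => Real.exp (-(R.u3.κ * R.u3.C.d X))) Cw S.vol Λg K) →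
          (∀ K t, |t| ≤ S.l₀ → ∀ τ ∈ S.T K \ S.Bad K t,
            WindowMultiplicity (L.facO K t τ) L.scO L.wO Cw S.vol Λg (jlogOf L.Cl K) K) →
          1 ≤ Λg → L.θ' ≤ Λg →
          LedgerAtSync { L with S := Sz, E₀ := E₀, m := m, a := a, Cw := Cw, Λg := Λg } S.l₀ S.vol S.T S.Bad
            (fun K t τ => S.A K t τ - S.shA K t τ) (fun K t τ => S.B K t τ - S.shB K t τ) Rd R.u3.EA EB R.u3.κ g uA uB
            R.u3.ω θc R.u3.θ θ₃) ∧
        0 ≤ S.vol ∧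
        (∀ K t, |t| ≤ S.l₀ → ∀ τ ∈ S.T K \ S.Bad K t,
          WindowMultiplicity (L.facO K t τ) L.scO L.wO L.Cw S.vol L.Λg (jlogOf L.Cl K) K) ∧
        0 ≤ L.Cw ∧ 1 ≤ L.Λg ∧ L.θ' ≤ L.Λg ∧
        -- (ii-m) the reference ledger's lattice identification
        (∀ K, (Pf K).d = d₀) ∧ (∀ K, (Pf K).L = L₀) ∧ (∀ K, (Pf K).K = Koff + K) ∧
        (∀ K, (Fintype.card (Site (Pf K) (Pf K).K) : ℝ) = S.vol) ∧
        kappa₀ (4 * 2 ^ d₀) (2 * d₀) ≤ R.u3.κ ∧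
        (∀ K, ∀ X ∈ L.All K,
          (cells K (R.u3.C.scale X + Koff) X).Nonempty ∧ TFaceConnected (cells K (R.u3.C.scale X + Koff) X)) ∧
        (∀ K j, Set.InjOn (cells K j) ↑((L.All K).filter fun X => R.u3.C.scale X + Koff = j)) ∧
        (∀ K, ∀ X ∈ L.All K, torusTreeLen (cells K (R.u3.C.scale X + Koff) X) ≤ R.u3.C.d X) ∧
        -- (iii) [III] Theorem 2 (2.43) AS PRINTED with window letters
        B14.Thm2Printed H033 fam Lb βw κ₁ ∧ βw < 1 ∧ 0 < βw ∧ 1 < Lb ∧ 1 ≤ Gv ∧ 0 ≤ Cl ∧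
        -- (iv) the positional-count half of N14's pinned pair at a rate `≤ R.ne1.Λ`
        (∀ p K, (R.ne1.𝒯.B p K).PositionalCount fun j k => N₀ * Λ₀ ^ (k - j)) ∧ 0 ≤ N₀ ∧ 0 ≤ Λ₀ ∧ Λ₀ ≤ R.ne1.Λ ∧
        -- (ii-v-A) run A's vacuum slices ↔ printed E-terms
        (∀ K t, |t| ≤ S.l₀ → ∀ τ ∈ S.T K \ S.Bad K t, ∀ v ∈ Rd.dom, ∀ j ≤ K, ∃ (i : I) (w : (fam i).Ω) (j' : ℕ),
          (fam i).flow.SatisfiesRG (fam i).K ∧ H033 (fam i).flow (fam i).K ∧ 1 ≤ j' ∧ j' ≤ (fam i).K ∧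
          (fam i).K - j' = K - j ∧ (fam i).K ≤ K + K₁ ∧
          (∀ n, 0 ≤ (fam i).gammaVol n w) ∧ (fam i).gammaVol (fam i).K w ≤ S.vol ∧
          (∀ n, n < (fam i).K → n < jlogOf Cl (fam i).K → (fam i).gammaVol n w = 0) ∧
          (∀ n, n < (fam i).K → jlogOf Cl (fam i).K ≤ n → (fam i).gammaVol n w ≤ S.vol * Gv ^ ((fam i).K - n)) ∧
          |∑ X ∈ (L.fac K t τ).filter (fun X => ¬ dressed X) with R.u3.C.scale X = j,
              (R.u3.EA (g K) (uA K v) X - R.u3.EA (g K) L.oneA X)| ≤ |(fam i).eTerm j' (fam i).K w|) ∧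
        -- (ii-v-B) run B's vacuum slices ↔ printed E-terms
        (∀ K t, |t| ≤ S.l₀ → ∀ τ ∈ S.T K \ S.Bad K t, ∀ v ∈ Rd.dom, ∀ j ≤ K, ∃ (i : I) (w : (fam i).Ω) (j' : ℕ),
          (fam i).flow.SatisfiesRG (fam i).K ∧ H033 (fam i).flow (fam i).K ∧ 1 ≤ j' ∧ j' ≤ (fam i).K ∧
          (fam i).K - j' = K - j ∧ (fam i).K ≤ K + K₁ ∧
          (∀ n, 0 ≤ (fam i).gammaVol n w) ∧ (fam i).gammaVol (fam i).K w ≤ S.vol ∧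
          (∀ n, n < (fam i).K → n < jlogOf Cl (fam i).K → (fam i).gammaVol n w = 0) ∧
          (∀ n, n < (fam i).K → jlogOf Cl (fam i).K ≤ n → (fam i).gammaVol n w ≤ S.vol * Gv ^ ((fam i).K - n)) ∧
          |∑ X ∈ (L.fac K t τ).filter (fun X => ¬ dressed X) with R.u3.C.scale X = j,
              (EB (fun i => g (K + 1) (i + 1)) (uB K v) X - EB (fun i => g (K + 1) (i + 1)) L.oneB X)|
            ≤ |(fam i).eTerm j' (fam i).K w|) ∧
        -- (ii-d) the dressed sub-ledger ↔ N14's bookings on `R.ne1.𝒯`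
        (∀ K t, |t| ≤ S.l₀ → ∀ τ ∈ S.T K \ S.Bad K t, ∀ v ∈ Rd.dom,
          ∃ (pA : R.ne1.P) (βA : R.u3.C.Dom → (R.ne1.𝒯.B pA K).Birth) (Q : Finset (R.ne1.𝒯.B pA K).Cube) (pB : R.ne1.P)
            (KB : ℕ) (βB : R.u3.C.Dom → (R.ne1.𝒯.B pB KB).Birth),
          (∀ X ∈ (L.fac K t τ).filter (fun X => dressed X), (R.ne1.𝒯.B pA K).birthScale (βA X) = R.u3.C.scale X) ∧
          (∀ j, Set.InjOn βA ↑(((L.fac K t τ).filter (fun X => dressed X)).filter fun X => R.u3.C.scale X = j)) ∧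
          (∀ c ∈ Q, (R.ne1.𝒯.B pA K).cubeScale c = K) ∧ ((Q.card : ℝ) ≤ S.vol) ∧
          (∀ X ∈ (L.fac K t τ).filter (fun X => dressed X), ∃ c ∈ Q, βA X ∈ (R.ne1.𝒯.B pA K).feltAt c) ∧
          (∀ X ∈ (L.fac K t τ).filter (fun X => dressed X), KB - (R.ne1.𝒯.B pB KB).birthScale (βB X) = K - R.u3.C.scale X) ∧
          (∀ X ∈ (L.fac K t τ).filter (fun X => dressed X),
            |R.u3.EA (g K) (uA K v) X - R.u3.EA (g K) L.oneA X| ≤ (R.ne1.𝒯.B pA K).size (βA X) K) ∧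
          (∀ X ∈ (L.fac K t τ).filter (fun X => dressed X),
            |EB (fun i => g (K + 1) (i + 1)) (uB K v) X - EB (fun i => g (K + 1) (i + 1)) L.oneB X|
              ≤ (R.ne1.𝒯.B pB KB).size (βB X) KB)) ∧
        -- (v′-16) N16 BY NAME: THE END's regime letters of `R.ne3`, N07's interface, the selection, NE7 route-#1's side letters, the
        -- reading map, the action-reading identification, the offset, the gauge-domination convention
        R.ne3.g = gradConst 4 c' ∧ 1 ≤ R.ne3.Nper ∧ 0 ≤ R.ne3.b ∧ 0 ≤ c' ∧ R.ne3.b ≤ t ∧ c' ≤ t ∧ 0 ≤ R.ne3.C ∧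
        (2 : ℝ) ^ 91 * (R.ne3.L : ℝ) ^ 17 * t ≤ 1 ∧ (2 : ℝ) ^ 76 * (R.ne3.L : ℝ) ^ 12 * t ≤ R.ne3.ε ∧
        16 * B7Prop2Explicit.C0 4 * R.ne3.ε ≤ 3 ∧ 1024 * (4 + 1) * (4 + 4) * (R.ne3.L : ℝ) ^ 2 * R.ne3.ε ≤ 1 ∧
        ε₁ ≤ 1 / 4 ∧ ε₁ ≤ R.ne3.b ∧ 4 * ε₁ ≤ c' ∧ R.ne3.dom ⊆ sfClass 4 R.ne3.L R.ne3.Nper ε₁ 0 ∧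
        LeafH3sup 4 R.ne3.L R.ne3.Nper R.ne3.ε R.ne3.b c' R.ne3.dom ∧
        (∀ V ∈ R.ne3.dom, ∀ k : ℕ, IsMinimiser 4 (sfClass 4 R.ne3.L R.ne3.Nper R.ne3.ε) R.ne3.L R.ne3.Nper k V (sel k V)) ∧
        (∀ V ∈ R.ne3.dom, ∀ k : ℕ, RegularSup 4 R.ne3.L R.ne3.Nper R.ne3.b c' k (sel k V)) ∧
        0 < θ ∧ θ ^ 6 = ((R.ne3.L : ℝ))⁻¹ ∧ 0 < R.ne3.Λ₂' ∧ 0 < γ₃ ∧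
        R.ne3.C * (wallConst 4 R.ne3.L * (R.ne3.Nper : ℝ) ^ 2 *
          (Real.sqrt (gradConst 4 c') * dualC2 4 R.ne3.L + 2 * R.ne3.b ^ 2 * dualC1 4 R.ne3.L)) ≤ γ₃ ^ 3 ∧
        0 < l₁ ∧ R.ne3.Λ₁ ≤ l₁ ^ 3 ∧ γ₃ * θ ^ 2 ≤ l₁ * R.ne3.Nper ∧ θ ^ ((3 : ℝ) * β - 2) ≤ θ₃ ∧ θ₃ < 1 ∧
        (∀ v ∈ Rd.dom, rd v ∈ R.ne3.dom) ∧
        (∀ k, ∀ v ∈ Rd.dom, Rd.act k v = minAct 4 (sfClass 4 R.ne3.L R.ne3.Nper R.ne3.ε) R.ne3.L R.ne3.Nper k (rd v)) ∧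
        (R.ne3.Nper : ℝ) ^ 4 ≤ Rd.vol ∧ 1 ≤ k₀ ∧
        (∀ K : ℕ, ∀ v ∈ Rd.dom, ∀ (u : B7Prop1Explicit.Site 4 → (Matrix (Fin N) (Fin N) ℂ)ˣ)
          (Z : B7Prop1Explicit.Site 4 → Fin 4 → Matrix (Fin N) (Fin N) ℂ) (M : ℝ),
          IsUnitarySite u → IsPeriodicSite u ((R.ne3.Nper * R.ne3.L ^ (k₀ + K) : ℕ) : ℤ) → T4AveragingDeficitWall.IsSkewDir Z →
          IsPeriodicDir Z ((R.ne3.Nper * R.ne3.L ^ (k₀ + K) : ℕ) : ℤ) →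
          B7Prop1Explicit.gaugeAct u (sel (k₀ + K) (rd v)) =
            T4AveragingDeficitWall.vary (B7Prop2Explicit.rescale R.ne3.L (B7Prop1Explicit.bavg R.ne3.L (sel (k₀ + K + 1) (rd v)))) Z 1 →
          (∀ (x : B7Prop1Explicit.Site 4) (κ : Fin 4), (R.ne3.L : ℝ) ^ (k₀ + K) * ‖Z x κ‖ ≤ M) →
          (∀ (x : B7Prop1Explicit.Site 4) (μ κ : Fin 4), ((R.ne3.L : ℝ) ^ (k₀ + K)) ^ 2 *
              ‖T4AveragingDeficitWall.Ad (B7Prop2Explicit.rescale R.ne3.L (B7Prop1Explicit.bavg R.ne3.L (sel (k₀ + K + 1) (rd v)))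
                  (x + B7Prop1Explicit.e κ) μ) (Z (x + B7Prop1Explicit.e μ) κ) - Z x κ‖ ≤ M) →
          R.u3.C.gauge (uA K v) (R.u3.C.transport (uB K v)) ≤ M) ∧
        -- (v′-17) N17 BY NAME, what is left of it: the smallness window AT THE TUNING RADIUS `γ` and K1⁷'s `b` from scale 0, rates (run identification ∕ infrared pin ∕
        -- box are the pin's, the β-window is K1⁷'s)
        R.u3.cr * R.u3.C₉ * R.u3.ω * (γ ^ 3 + 2 * γ / b) ≤ (1 - R.u3.ρ) / 2 ∧
        0 < R.u3.ρ ∧ R.u3.ρ ≤ θc ∧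
        -- the bracket (T) IN THE TUBE CURRENCY, what is left of it: the (1.18) real bound; the pair-disc shape at the printed tube radius κ₁·α(C₁, q₁, s_j)
        -- ((2.27)(ii)(iv) through the (1.13)∕(2.39) tube — SHAPE, NODE O); signs (the upper running and both window memberships are the pin's)
        DecayBound R.u3.EA R.u3.W E₀T R.u3.κ ∧
        (∀ s ∈ R.u3.W, ∀ (X : R.u3.C.Dom) (U U' : R.u3.C.BgA),
          R.u3.C.gauge U U' < κ₁T * B14.alphaJ C₁T q₁ (s (R.u3.C.scale X)) →
          ∃ f : ℂ → ℂ, DifferentiableOn ℂ f (Metric.ball (0 : ℂ) (κ₁T * B14.alphaJ C₁T q₁ (s (R.u3.C.scale X)))) ∧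
            f 0 = (R.u3.EA s U X : ℂ) ∧ f (R.u3.C.gauge U U' : ℂ) = (R.u3.EA s U' X : ℂ) ∧
            ∀ z ∈ Metric.ball (0 : ℂ) (κ₁T * B14.alphaJ C₁T q₁ (s (R.u3.C.scale X))),
              ‖f z‖ ≤ E₀T * Real.exp (-(R.u3.κ * R.u3.C.d X))) ∧
        0 ≤ E₀T ∧ 0 < κ₁T ∧ 0 < C₁T ∧
        -- selector compatibility
        (∀ s ∈ R.u3.W, 0 < bsel s ∧ bsel s ≤ R.u3.γ))

include hβ1 hlink

/-- ★★ **N19′'s EDGE GIVEN K3⁷'s RATES PREDICATE ON TUNED BARE SEQUENCES, MODULO THE LINK READING AT THE RUNS OF RECORD, β-WINDOW ALONG THE RUNS** [bookkeeping]: at every guarded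
admissible Stage-13 tuple, every bare sequence `g₀` TUNED to `gIR` within `]0, γ]`, `γ ≤ θ.γ` ([Balaban1987RG1] Thm 2 p. 259's renormalisation condition at the
datum of record — a HYPOTHESIS), with `b ≤ β ≤ b′` ALONG ITS RUNS OF RECORD, `0 < b` (K1⁷'s window; a HYPOTHESIS), every `os`, run length `k`:
`RatesHolderAt D R β ∧ ReadOutAt D R.u3 ∧ (0 ≤ R.u3.ρ ∧ R.u3.ρ < 1) → ∃ δ, NE7.Core (cr …) … δ ∧ Summable δ` for `R := rateCarriersOfRecord₁₃CoPH 𝔯 F θ hP g₀ os k`,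
`D := datumOfRecord₁₃CoPH F N θ hP`.  Proof: E′ `N19RateEdgeHolderAlong.rateEdge_of_linkReadingAlong_byName_pairDiscC1Holder` at the same-tuple pair predicate carrying the
slot's `ReadOutAt`, `ρ < 1`, the tuning, `γ ≤ θ.γ`, `0 < b` and both along-the-runs bounds; its along-form «v9» obligation REASSEMBLED from `hlink`, J's seven named facts,
AtRuns §1's seven run clauses at the pinned `g` (box at the tuning radius), and INTENT-5's `alongLower_of_pinnedRuns` (`bβ := b`, `k₀β := 0`, `γt := γ`, `β′_T := max b′ 0`).  NOT NE7; N19 NOT discharged;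
`hlink` (NODE O's world at the runs of record + the remaining in-edge letters) DISPLAYED. -/
theorem h19HolderD4_datumOfRecord₁₃CoPH_of_linkReadingAtRunsAlong_tuned
    (F : T4Family) (θ : Stage13HParams F N) (hP : θ.Provisos₁₃CoPH F N) (hG : G θ) (hθ : θ.Admissible F N) {γ gIR b' : ℝ} {g₀ : ℕ → ℝ}
    (ht : (datumOfRecord₁₃CoPH F N θ hP).Tuned γ gIR g₀) (hγle : γ ≤ θ.γ) {b : ℝ} (hb0 : 0 < b)
    (hlow : ∀ K m, 0 ≤ m → m < K →
      b ≤ (datumOfRecord₁₃CoPH F N θ hP).βfun m (prefixOf (runFlow (datumOfRecord₁₃CoPH F N θ hP) g₀ K) m))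
    (halong : ∀ K i, i < K →
      (datumOfRecord₁₃CoPH F N θ hP).βfun i (prefixOf (runFlow (datumOfRecord₁₃CoPH F N θ hP) g₀ K) i) ≤ b')
    (os : List (ULoop F)) (k : ℕ)
    (hP4 : RatesHolderAt (datumOfRecord₁₃CoPH F N θ hP) (rateCarriersOfRecord₁₃CoPH 𝔯 F θ hP g₀ os k) β ∧
      ReadOutAt (datumOfRecord₁₃CoPH F N θ hP) (rateCarriersOfRecord₁₃CoPH 𝔯 F θ hP g₀ os k).u3 ∧
      (0 ≤ (rateCarriersOfRecord₁₃CoPH 𝔯 F θ hP g₀ os k).u3.ρ ∧ (rateCarriersOfRecord₁₃CoPH 𝔯 F θ hP g₀ os k).u3.ρ < 1)) :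
    letI := (cr F θ hP g₀ os).dec
    ∃ δ : ℕ → ℝ, NE7.Core (cr F θ hP g₀ os).l₀ (cr F θ hP g₀ os).vol (cr F θ hP g₀ os).T (cr F θ hP g₀ os).Bad
      (fun K t τ => (cr F θ hP g₀ os).A K t τ - (cr F θ hP g₀ os).shA K t τ) (fun K t τ => (cr F θ hP g₀ os).B K t τ - (cr F θ hP g₀ os).shB K t τ) δ ∧
      Summable δ :=
  rateEdge_of_linkReadingAlong_byName_pairDiscC1Holder
    (fun F D g₀ os S R => ∃ (θ : Stage13HParams F N) (hP : θ.Provisos₁₃CoPH F N) (k : ℕ) (γ gIR b b' : ℝ), G θ ∧ θ.Admissible F N ∧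
      D = datumOfRecord₁₃CoPH F N θ hP ∧ S = cr F θ hP g₀ os ∧ R = rateCarriersOfRecord₁₃CoPH 𝔯 F θ hP g₀ os k ∧ ReadOutAt D R.u3 ∧ R.u3.ρ < 1 ∧
      (datumOfRecord₁₃CoPH F N θ hP).Tuned γ gIR g₀ ∧ γ ≤ θ.γ ∧ 0 < b ∧
      (∀ K m, 0 ≤ m → m < K → b ≤ (datumOfRecord₁₃CoPH F N θ hP).βfun m (prefixOf (runFlow (datumOfRecord₁₃CoPH F N θ hP) g₀ K) m)) ∧
      ∀ K i, i < K → (datumOfRecord₁₃CoPH F N θ hP).βfun i (prefixOf (runFlow (datumOfRecord₁₃CoPH F N θ hP) g₀ K) i) ≤ b')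
    hβ1 (by
      rintro F D g₀ os S R ⟨θ, hP, k, γ, gIR, b, b', hG, hθ, rfl, rfl, rfl, hD4, hρ1, ht, hγle, hb0, hlow, halong⟩
      -- destructure the reading at the runs of record IN STAGES (as E and J), then reassemble v9's along-form clause
      obtain ⟨hγe, iDom, F', ι', X', iMeas, L, Rd, bsel, EB, θc, θ₃, g, uA, uB, hrest⟩ := hlink F θ hP hG hθ γ gIR b g₀ ht hγle hb0 hlow os k
      obtain ⟨Pf, d₀, L₀, Koff, cells, H033, I, fam, Lb, βw, κ₁, Gv, Cl, K₁, Λ₀, N₀, dressed, iDr, hrest⟩ := hrest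
      obtain ⟨c', t, ε₁, ϑ, γ₃, l₁, sel, rd, k₀, E₀T, κ₁T, C₁T, q₁, hrest⟩ := hrest
      obtain ⟨hgle, hggt, hEB, hL, hvol, homult, hCw, hΛg, hθΛ, hPd, hPL, hPK, hcard, hκ₀, hdom, hinj, hlen, hrest⟩ := hrest
      obtain ⟨h11, hβw1, hβw0, hLb, hGv, hCl, hcount, hN₀, hΛ₀, hle, hidA, hidB, hidD, hrest⟩ := hrest
      obtain ⟨hg3, hNper, hb, hc', hbt, hct, hC3, hsmall3, hεt, hε1, hε2, hε₁, hε₁b, hε₁c, hdom3, hH3, hsel, hreg, hrest⟩ := hrest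
      obtain ⟨hθ0, hθ6, hΛ₂', hγ₃, hγ3, hl₁, hΛl₁, hfit, hθ₃θ, hθ₃1, hrd, hact, hvol3, hk₀, hdomC1, hrest⟩ := hrest
      obtain ⟨hsmallb, hρ0, hρθc, hdecT, hdiscT, hE₀T, hκ₁T, hC₁T, hbsel⟩ := hrest
      have hsg := signs_rateCarriersOfRecord₁₃CoPH_of_readOutAt 𝔯 θ hP g₀ os k hD4
      -- the SEVEN run clauses at the PINNED runs (AtRuns §1; (0.20) along the runs of record = the datum's guard, this seat's g0)
      have hrg := rgEqH_runFlow_datumOfRecord₁₃CoPH_of_tuned θ hP ht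
      -- windows at the carriers' radius `θ.γ`, the box at the TUNING radius `γ` (AtRuns §1 twice)
      obtain ⟨hrun, hpin, -, hgA, hgB, -, -⟩ := runClauses_of_pinnedRuns_tuned (datumOfRecord₁₃CoPH F N θ hP) hrg ht hγle hgle hggt
      obtain ⟨-, -, hboxt, -, -, hIR0, hIRγ⟩ := runClauses_of_pinnedRuns_tuned (datumOfRecord₁₃CoPH F N θ hP) hrg ht le_rfl hgle hggt
      have hup := invSq_of_pinnedRuns_along (datumOfRecord₁₃CoPH F N θ hP) hrg halong ht hgle
      -- the β-window along the PINNED runs from the along-the-runs-of-record bound (INTENT-5's transport), `k₀β := 0`, `bβ := b`, `γt := γ`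
      have hlo := alongLower_of_pinnedRuns (datumOfRecord₁₃CoPH F N θ hP) hgle hlow
      have hsmallβ : (rateCarriersOfRecord₁₃CoPH 𝔯 F θ hP g₀ os k).u3.cr * (rateCarriersOfRecord₁₃CoPH 𝔯 F θ hP g₀ os k).u3.C₉ *
          (rateCarriersOfRecord₁₃CoPH 𝔯 F θ hP g₀ os k).u3.ω * ((((0 : ℕ) : ℝ) + 1) * γ ^ 3 + 2 * γ / b) ≤
            (1 - (rateCarriersOfRecord₁₃CoPH 𝔯 F θ hP g₀ os k).u3.ρ) / 2 := by
        simpa only [Nat.cast_zero, zero_add, one_mul] using hsmallb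
      refine ⟨iDom, F', ι', X', iMeas, L, Rd, bsel, EB, θc, θ₃, g, uA, uB, Pf, d₀, L₀, Koff, cells, H033, I, fam, Lb, βw, κ₁, Gv, Cl, K₁, Λ₀, N₀,
        dressed, iDr, c', t, ε₁, ϑ, γ₃, l₁, sel, rd, k₀, gIR, b, γ, 0, E₀T, κ₁T, C₁T, max b' 0, q₁, hEB, hL, hvol, homult, hCw, hΛg, hθΛ, hPd, hPL,
        hPK, hcard, hκ₀, hdom, hinj, hlen, h11, hβw1, hβw0, hLb, hGv, hCl, hcount, hN₀, hΛ₀, hle, hidA, hidB, hidD, ?_⟩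
      exact ⟨hg3, two_le_ne3_L_rateCarriersOfRecord₁₃CoPH 𝔯 θ hP g₀ os k, hNper, hb, hc', hbt, hct, hC3, hsmall3, hεt, hε1, hε2, hε₁, hε₁b, hε₁c,
        hdom3, hH3, hsel, hreg, hθ0, hθ6, hΛ₂', hγ₃, hγ3, hl₁, hΛl₁, hfit, hθ₃θ, hθ₃1, hrd, hact, hvol3, hk₀, hdomC1,
        hsg.1, hsg.2.1, hsg.2.2, hrun, hpin, hD4, hb0, hlo, lt_of_lt_of_le hIR0 hIRγ, hγle, hsmallβ, hρ0, hρ1,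
        gamma_pos_rateCarriersOfRecord₁₃CoPH 𝔯 θ hP hθ g₀ os k, hρθc, hboxt,
        hdecT, hdiscT, hE₀T, hκ₁T, hC₁T, window_rateCarriersOfRecord₁₃CoPH_sq_le_exp_neg_one 𝔯 θ hP g₀ os k hγe, hup, le_max_right _ _, hgA, hgB,
        hbsel⟩)
    F _ g₀ os _ _ ⟨θ, hP, k, γ, gIR, b, b', hG, hθ, rfl, rfl, rfl, hP4.2.1, hP4.2.2.2, ht, hγle, hb0, hlow, halong⟩ hP4.1

/-! ## §2 UNDER THE CRUX's PREFIX BY NAME, BOTH HALVES OF K1⁷'s WINDOW READ -/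

/-- ★★ **N19′'s SLOT UNDER THE `ForSmallCouplings` PREFIX, MODULO THE LINK READING AT THE RUNS OF RECORD, THE β-WINDOW K1⁷'s** [bookkeeping]: at every guarded admissible
Stage-13 tuple carrying K1⁷'s interval-form β-window `BetaBoundsInInterval D.C.toB12 γ₀ b b′` with `0 < b` (N24's binder at the ₁₃ record; lower half UNPRINTED T09.F, upper half
[Balaban1987RG1] (1.22) p. 264 — a HYPOTHESIS; BOTH halves read: `alongLower_runFlow_of_tuned`, `betaAlong_runFlow_le_of_betaBoundsInInterval`): FOR ALL SMALL COUPLINGS —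
threshold `γ₀′ := min γ₀ θ.γ`, the `g`-threshold idle, `ForSmallCouplings` BY NAME — every `os`, run length `k`: `PHolderD4 β D R → ∃ δ, NE7.Core (cr …) … δ ∧ Summable δ`.
This is the `g₀`-clause of J's slot theorem restricted to the prefix the K3⁷ item's conclusion `HybridNE7Under` and its extraction slot live under; (B) and
`EndpointExistence` are not used.  NOT NE7; N19 NOT discharged; NOT a proof of `stub_expansion13H` (whose N19′ slot quantifies over every `g₀`). -/
theorem forSmallCouplings_h19HolderD4_datumOfRecord₁₃CoPH_of_linkReadingAtRunsAlong
    (F : T4Family) (θ : Stage13HParams F N) (hP : θ.Provisos₁₃CoPH F N) (hG : G θ) (hθ : θ.Admissible F N) {γ₀ b b' : ℝ} (hγ₀ : 0 < γ₀) (hb0 : 0 < b)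
    (hβ : DagBinding.BetaBoundsInInterval (datumOfRecord₁₃CoPH F N θ hP).C.toB12 γ₀ b b') :
    ForSmallCouplings (datumOfRecord₁₃CoPH F N θ hP) fun g₀ => ∀ (os : List (ULoop F)) (k : ℕ),
      (RatesHolderAt (datumOfRecord₁₃CoPH F N θ hP) (rateCarriersOfRecord₁₃CoPH 𝔯 F θ hP g₀ os k) β ∧
        ReadOutAt (datumOfRecord₁₃CoPH F N θ hP) (rateCarriersOfRecord₁₃CoPH 𝔯 F θ hP g₀ os k).u3 ∧
        (0 ≤ (rateCarriersOfRecord₁₃CoPH 𝔯 F θ hP g₀ os k).u3.ρ ∧ (rateCarriersOfRecord₁₃CoPH 𝔯 F θ hP g₀ os k).u3.ρ < 1)) →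
      letI := (cr F θ hP g₀ os).dec
      ∃ δ : ℕ → ℝ, NE7.Core (cr F θ hP g₀ os).l₀ (cr F θ hP g₀ os).vol (cr F θ hP g₀ os).T (cr F θ hP g₀ os).Bad
        (fun K t τ => (cr F θ hP g₀ os).A K t τ - (cr F θ hP g₀ os).shA K t τ) (fun K t τ => (cr F θ hP g₀ os).B K t τ - (cr F θ hP g₀ os).shB K t τ) δ ∧
        Summable δ := by
  refine ⟨min γ₀ θ.γ, lt_min hγ₀ hθ.toStage9.gamma_pos, fun γ _ hγle => ⟨1, one_pos, fun gIR _ _ g₀ ht os k hP4 => ?_⟩⟩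
  exact h19HolderD4_datumOfRecord₁₃CoPH_of_linkReadingAtRunsAlong_tuned cr 𝔯 G hβ1 hlink F θ hP hG hθ ht (hγle.trans (min_le_right _ _)) hb0
    (alongLower_runFlow_of_tuned _ hβ (hγle.trans (min_le_left _ _)) ht)
    (fun K i hi => betaAlong_runFlow_le_of_betaBoundsInInterval _ hβ (hγle.trans (min_le_left _ _)) (ht K).1 i hi) os k hP4

/-- ★ **K3⁷ v2's N19′ SLOT TEXT UNDER THE PREFIX** (`KeyedCoreEdgeHolderD4 β cr (rrOfRecord 𝔯 ks)`'s `g₀ os`-clause, UNFOLDED — the skeleton's `def`s are local to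
it — for a run-length selector `ks`, restricted to `ForSmallCouplings`): §3 at `k := ks F θ hP g₀ os`.  At `N = 2`, `G := θ.ZhUnity F 2 ∧ θ.SlotsNondegenerate₁₃ F 2`,
`cr := crOfRecord₁₃(V)At …` this is the slot's body under the prefix, modulo `hlink` and K1⁷'s window; NOT a proof of stub 2; NOT NE7. [bookkeeping] -/
theorem forSmallCouplings_keyedCoreEdgeHolderD4_of_linkReadingAtRunsAlong
    (ks : (F : T4Family) → (θ : Stage13HParams F N) → θ.Provisos₁₃CoPH F N → (ℕ → ℝ) → List (ULoop F) → ℕ)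
    (F : T4Family) (θ : Stage13HParams F N) (hP : θ.Provisos₁₃CoPH F N) (hG : G θ) (hθ : θ.Admissible F N) {γ₀ b b' : ℝ} (hγ₀ : 0 < γ₀) (hb0 : 0 < b)
    (hβ : DagBinding.BetaBoundsInInterval (datumOfRecord₁₃CoPH F N θ hP).C.toB12 γ₀ b b') :
    ForSmallCouplings (datumOfRecord₁₃CoPH F N θ hP) fun g₀ => ∀ (os : List (ULoop F)),
      (RatesHolderAt (datumOfRecord₁₃CoPH F N θ hP) (rateCarriersOfRecord₁₃CoPH 𝔯 F θ hP g₀ os (ks F θ hP g₀ os)) β ∧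
        ReadOutAt (datumOfRecord₁₃CoPH F N θ hP) (rateCarriersOfRecord₁₃CoPH 𝔯 F θ hP g₀ os (ks F θ hP g₀ os)).u3 ∧
        (0 ≤ (rateCarriersOfRecord₁₃CoPH 𝔯 F θ hP g₀ os (ks F θ hP g₀ os)).u3.ρ ∧
          (rateCarriersOfRecord₁₃CoPH 𝔯 F θ hP g₀ os (ks F θ hP g₀ os)).u3.ρ < 1)) →
      letI := (cr F θ hP g₀ os).dec
      ∃ δ : ℕ → ℝ, NE7.Core (cr F θ hP g₀ os).l₀ (cr F θ hP g₀ os).vol (cr F θ hP g₀ os).T (cr F θ hP g₀ os).Bad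
        (fun K t τ => (cr F θ hP g₀ os).A K t τ - (cr F θ hP g₀ os).shA K t τ) (fun K t τ => (cr F θ hP g₀ os).B K t τ - (cr F θ hP g₀ os).shB K t τ) δ ∧
        Summable δ :=
  (forSmallCouplings_h19HolderD4_datumOfRecord₁₃CoPH_of_linkReadingAtRunsAlong cr 𝔯 G hβ1 hlink F θ hP hG hθ hγ₀ hb0 hβ).mono fun g₀ h os =>
    h os (ks F θ hP g₀ os)

/-! ## §3 THE PLUG (any reading `cr`): K3⁷'s conclusion at every guarded admissible tuple from v2∕v3's other faces, THIS reading under the prefix, K1⁷'s window -/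

/-- ★★ **THE PLUG AT ANY READING `cr`, β-WINDOW FROM K1⁷** [bookkeeping]: from N20 ∕ N21 at `cr` (leaf D's `h20`∕`h21` shapes), v2∕v3's ∀-`g₀` rates `PHolderD4 β` (spelled
out) at `rr := rateCarriersOfRecord₁₃CoPH 𝔯 … (ks …)`, leaf D's extraction clause `hx` at `cr`, K1⁷'s interval-form window with `0 < b` at every guarded admissible tuple
(`hβw`; `DagBinding.WorldP.b_pos`), AND THIS FILE's link reading `hlink`: `HybridNE7Under (datumOfRecord₁₃CoPH F N θ hP) (EndpointExistence …)` at every guarded admissible tuple —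
this seat's composer `N19CoreEdgeFSCComposer.keyedGuarded₁₃CoPH_of_fscCoreEdgeHolderD4_betaWindowPos` (p595910) with `h19w := §2`.  At `N = 2`, `G := θ.ZhUnity F 2 ∧
θ.SlotsNondegenerate₁₃ F 2` the conclusion is K3⁷'s as leaf D states it — MODULO `hlink` (NODE O's world at the runs of record, 0∕1 inhabited), the other slots and K1⁷'s
window.  NOT a proof of K3⁷ or of any stub; N19 NOT discharged. -/
theorem hybridNE7Under_datumOfRecord₁₃CoPH_of_linkReadingAtRunsAlong
    (ks : (F : T4Family) → (θ : Stage13HParams F N) → θ.Provisos₁₃CoPH F N → (ℕ → ℝ) → List (ULoop F) → ℕ)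
    (h20 : ∀ (F : T4Family) (θ : Stage13HParams F N) (hP : θ.Provisos₁₃CoPH F N), G θ → θ.Admissible F N → ∀ (g₀ : ℕ → ℝ) (os : List (ULoop F)),
      RelWeightBound (cr F θ hP g₀ os).l₀ (cr F θ hP g₀ os).T (cr F θ hP g₀ os).A (cr F θ hP g₀ os).B (cr F θ hP g₀ os).Bad (cr F θ hP g₀ os).W)
    (h21 : ∀ (F : T4Family) (θ : Stage13HParams F N) (hP : θ.Provisos₁₃CoPH F N), G θ → θ.Admissible F N → ∀ (g₀ : ℕ → ℝ) (os : List (ULoop F)),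
      ShellWeightBound (cr F θ hP g₀ os).l₀ (cr F θ hP g₀ os).T (cr F θ hP g₀ os).A (cr F θ hP g₀ os).B (cr F θ hP g₀ os).shA (cr F θ hP g₀ os).shB
        (cr F θ hP g₀ os).Wsh)
    (hrates : ∀ (F : T4Family) (θ : Stage13HParams F N) (hP : θ.Provisos₁₃CoPH F N), G θ → θ.Admissible F N → ∀ (g₀ : ℕ → ℝ) (os : List (ULoop F)),
      RatesHolderAt (datumOfRecord₁₃CoPH F N θ hP) (rateCarriersOfRecord₁₃CoPH 𝔯 F θ hP g₀ os (ks F θ hP g₀ os)) β ∧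
        ReadOutAt (datumOfRecord₁₃CoPH F N θ hP) (rateCarriersOfRecord₁₃CoPH 𝔯 F θ hP g₀ os (ks F θ hP g₀ os)).u3 ∧
        (0 ≤ (rateCarriersOfRecord₁₃CoPH 𝔯 F θ hP g₀ os (ks F θ hP g₀ os)).u3.ρ ∧ (rateCarriersOfRecord₁₃CoPH 𝔯 F θ hP g₀ os (ks F θ hP g₀ os)).u3.ρ < 1))
    (hβw : ∀ (F : T4Family) (θ : Stage13HParams F N) (hP : θ.Provisos₁₃CoPH F N), G θ → θ.Admissible F N →
      ∃ γ₀ b b' : ℝ, 0 < γ₀ ∧ 0 < b ∧ DagBinding.BetaBoundsInInterval (datumOfRecord₁₃CoPH F N θ hP).C.toB12 γ₀ b b')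
    (hx : ∀ (F : T4Family) (θ : Stage13HParams F N) (hP : θ.Provisos₁₃CoPH F N), G θ → θ.Admissible F N →
      B16.EndStatementBPrinted (datumOfRecord₁₃CoPH F N θ hP).C → DagBinding.EndpointExistence (datumOfRecord₁₃CoPH F N θ hP).C.toB12 →
        ForSmallCouplings (datumOfRecord₁₃CoPH F N θ hP) fun g₀ => ∀ os : List (ULoop F),
          0 < (cr F θ hP g₀ os).l₀ ∧ 0 < (cr F θ hP g₀ os).vol ∧
          (∀ (K : ℕ) (t : ℝ), |t| ≤ (cr F θ hP g₀ os).l₀ →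
            T4GenFunBounds.schemeZ ((datumOfRecord₁₃CoPH F N θ hP).scheme g₀) os ((cr F θ hP g₀ os).K₀ + K) t =
              ∑ τ ∈ (cr F θ hP g₀ os).T K, (cr F θ hP g₀ os).A K t τ) ∧
          (∀ (K : ℕ) (t : ℝ), |t| ≤ (cr F θ hP g₀ os).l₀ →
            T4GenFunBounds.schemeZ ((datumOfRecord₁₃CoPH F N θ hP).scheme g₀) os ((cr F θ hP g₀ os).K₀ + K + 1) t =
              ∑ τ ∈ (cr F θ hP g₀ os).T K, (cr F θ hP g₀ os).B K t τ))
    (F : T4Family) (θ : Stage13HParams F N) (hP : θ.Provisos₁₃CoPH F N) (hG : G θ) (hθ : θ.Admissible F N) :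
    HybridNE7Under (datumOfRecord₁₃CoPH F N θ hP) (DagBinding.EndpointExistence (datumOfRecord₁₃CoPH F N θ hP).C.toB12) :=
  keyedGuarded₁₃CoPH_of_fscCoreEdgeHolderD4_betaWindowPos cr G 𝔯 ks h20 h21 hrates
    (fun F θ hP hG hθ _ _ _ hγ₀ hb0 hβ => forSmallCouplings_keyedCoreEdgeHolderD4_of_linkReadingAtRunsAlong cr 𝔯 G hβ1 hlink ks F θ hP hG hθ hγ₀ hb0 hβ)
    hβw hx F θ hP hG hθ

end AtRecordRunsAlong

end Summit.QuantumFields.YangMills.BalabanUVNodes.N19RateEdgeHolderD4AtRunsAlong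

end
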